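import Literature.Geometry.Lorentzian.ConformalScalarFlatCore
import Literature.Geometry.Lorentzian.WeakSolutionRegularity
import Literature.Geometry.Lorentzian.ScalarCurvatureIntegrable
import Literature.Geometry.Lorentzian.DalembertianCompose
import HarnessLib

/-!
# Cor. 3.1 of Schoen–Yau 1979 from elliptic regularity and the asymptotic expansion

Schoen–Yau, Comm. Math. Phys. 65 (1979), Cor. 3.1 (p. 72): on a one-ended asymptotically flat
`3`-manifold with zero mass, `R ≥ 0` and `R ≢ 0`, some conformal metric is asymptotically flat,
scalar flat and of negative mass. The named fact `exists_conformal_negativeMass_of_massZero`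
(`PositiveMassRigidity.lean`) vendors it. The printed proof is Lemma 3.3 (the conformal factor
`φ = 1 + v`, `v` the solution of `Δv − (R/8)v = R/8` given by Lemma 3.2), and in this tree the
whole argument is now formalised **except for two analytic inputs**, which this file isolates as
the hypotheses of one reduction theorem:

* `hF : Folland1995_cor634` — elliptic regularity (Folland 1995, Cor. (6.34)), the existing
  named fact of `Literature/Analysis/Distribution/EllipticRegularity.lean`, used to upgrade the
  energy-space solution to a smooth one (`exists_smooth_solution_of_sobolev`,
  `WeakSolutionRegularity.lean`);
* `hasym` — the asymptotic half of Lemma 3.2 ((3.6)–(3.20)): smooth `L⁶` solutions of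
  `Δ_h v − (R/8) v = R/8` on such data expand as `v = A/r + O₂(r⁻²)` in the chart of the end.

Results:

* `integrable_abs_scalarCurvature_rpow` — `∫ |R|^p dV < ∞` for `p > 3/4` on one-ended data with
  `h − δ = o₅(r⁻²)` (so `|R/8|^{3/2}` and `|R/8|^{6/5}`, the integrability (3.3)-type hypotheses
  of Lemma 3.2 for `f = h = R/8`);
* `exists_conformal_negativeMass_of_massZero_of_regularity_and_asymptotics` — **the named fact
  from `hF` and `hasym`**: Lemma 3.1 (`AFEnd.sobolev_inequality`), the smooth energy-space
  solution with `θ = 0` (`exists_smooth_solution_of_sobolev`; Lax–Milgram,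
  `AFLinearWeakExistence.lean`, and interior regularity, `WeakSolutionRegularity.lean`),
  `φ = 1 + v` with `Δ_h φ = Rφ/8` ((3.22)–(3.23)), and the rest of the elliptic core —
  positivity (Hopf), the flux formula (3.16), `A < 0`, the conformal law and the mass of `φ⁴h` —
  from `exists_conformal_negativeMass_of_massZero_of_solution` (`ConformalScalarFlatCore.lean`).

Everything here is proved; no definitions, no named facts are introduced. A remark on `hasym`: the
scalar curvature of such data is only `o(r⁻⁴)`, and the Newtonian-potential expansion of an
`O(r⁻⁴)` source has an `O(r⁻² log r)` remainder in general; the `O(r⁻²)` claimed in (3.18)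
uses (implicitly) the boundedness of the dipole moments `∫_{|y|<ρ} R y dy`, which holds because
`R` is a double divergence at linear order (`R_lin = ∂ᵢ∂ⱼ hᵢⱼ − Δ tr h`). The monopole term of
that expansion is `NewtonPotentialFarField.lean`.

## References

* R. Schoen, S.-T. Yau, *On the proof of the positive mass conjecture in general relativity*,
  Comm. Math. Phys. 65 (1979) 45–76: Lemma 3.1 (p. 63), Lemma 3.2 (pp. 64–70), Lemma 3.3 and
  Cor. 3.1 (pp. 71–72). [SchoenYauPMT1979]
* G. B. Folland, *Introduction to Partial Differential Equations*, 2nd ed. (1995), Cor. (6.34).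
  [Folland2020]
-/

noncomputable section

open Set Function Filter Metric MeasureTheory Measure TopologicalSpace Bornology Asymptotics Manifold
  Bundle Module
open scoped Topology Manifold ContDiff ENNReal

namespace Literature.Geometry.Lorentzian

/-! ### `|R|^p` is integrable for `p > 3/4` -/

/-- **Powers of the scalar curvature are integrable**: on a one-ended asymptotically flat
`3`-manifold with `h − δ = o₅(r⁻²)` on the end, `∫ |R|^p dV_h < ∞` for every `p > 3/4`
(`|R| ≤ √3 ‖Ric‖ ≤ C r⁻⁴` on the end, `AFEnd.exists_bound_normSq_ricci`, the density bound
`√det h_{ij} ≤ 7`, and `∫_{r > R} r^{−4p} dz < ∞` for `4p > 3`; a compact core). For `p = 3/2`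
and `p = 6/5` these are the hypotheses (3.3)-type integrability of `f = h = R/8` in Schoen–Yau's
Lemma 3.2 as used in Lemma 3.3. [cite: SchoenYauPMT1979, Lemma 3.2 (3.3) and Lemma 3.3 (pp. 64, 71)] -/
theorem integrable_abs_scalarCurvature_rpow {X : Type} [TopologicalSpace X] [ChartedSpace E3 X]
    [IsManifold (𝓡 3) ∞ X] [T2Space X] [LocallyCompactSpace X] [MeasurableSpace X] [BorelSpace X]
    (D : InitialDataSet (𝓡 3) X) [D.metric.HasLeviCivita] (e : AFEnd X)
    (haf : e.IsStronglyAsymptoticallyFlatWith D 0 2 0 5 0) (hsole : e.IsSoleEnd)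
    {p : ℝ} (hp : 3 / 4 < p) :
    Integrable (fun x ↦ |D.metric.scalarCurvature x| ^ p) (riemannianMeasure D.h) := by
  set μ : Measure X := riemannianMeasure D.h with hμ
  set f : X → ℝ := D.metric.scalarCurvature with hf
  have hp0 : 0 < p := lt_trans (by norm_num) hp
  have hfc : Continuous f := D.metric.contMDiff_scalarCurvature.continuous
  have hFc : Continuous (fun x ↦ |f x| ^ p) := hfc.abs.rpow_const fun _ ↦ Or.inr hp0.le
  haveI : IsFiniteMeasureOnCompacts μ :=
    ⟨fun K hK ↦ riemannianVolume_lt_top_of_isCompact_holds D.h le_rfl hK⟩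
  -- pointwise: `f² ≤ 3 ‖Ric‖²`
  have hsq : ∀ x, f x ^ 2 ≤ 3 * D.metric.normSq x (D.metric.ricci x) := fun x ↦ by
    have h := D.metric.sq_scalarCurvature_le D.isRiemannian_metric x
    have h3 : (finrank ℝ E3 : ℝ) = 3 := by
      rw [finrank_euclideanSpace_fin]
      norm_num
    rwa [h3] at h
  -- decay on the end and the density bound
  have hAF : e.IsMetricAsymptoticallyFlat D 2 :=
    AFEnd.IsStronglyAsymptoticallyFlatWith.isMetricAsymptoticallyFlat_of_massZero e D haf
      (by norm_num)
  obtain ⟨K₀, R₁, hRR₁, h1R₁, hbound⟩ := e.exists_bound_normSq_ricci D two_pos hAF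
  obtain ⟨R₃, hdens⟩ := e.exists_radius_sqrt_det_hCoeff_le D two_pos hAF
  set K : ℝ := max K₀ 0 with hK
  have hK0 : 0 ≤ K := le_max_right _ _
  set R₂ : ℝ := max R₁ R₃ with hR₂
  have hR₁R₂ : R₁ ≤ R₂ := le_max_left _ _
  have hR₃R₂ : R₃ ≤ R₂ := le_max_right _ _
  have hRR₂ : e.R ≤ R₂ := hRR₁.le.trans hR₁R₂
  -- the pointwise bound `|f(Φ z)| ≤ √(3K) ‖z‖⁻⁴` for `‖z‖ ≥ R₁`
  have hptw : ∀ z : E3, R₁ ≤ ‖z‖ →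
      |f (e.dataChartExt z)| ≤ Real.sqrt (3 * K) * ‖z‖ ^ (-(4 : ℝ)) := by
    intro z hz
    have hz0 : 0 < ‖z‖ := lt_of_lt_of_le (lt_of_lt_of_le one_pos h1R₁) hz
    have hb := hbound z hz
    have h8 : ‖z‖ ^ (-(2 * (2 : ℝ) + 4)) = ‖z‖ ^ (-(8 : ℝ)) := by norm_num
    rw [h8] at hb
    have hb' : D.metric.normSq (e.dataChartExt z) (D.metric.ricci (e.dataChartExt z)) ≤
        K * ‖z‖ ^ (-(8 : ℝ)) :=
      hb.trans (mul_le_mul_of_nonneg_right (le_max_left _ _) (Real.rpow_nonneg hz0.le _))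
    have h2 : f (e.dataChartExt z) ^ 2 ≤ (Real.sqrt (3 * K) * ‖z‖ ^ (-(4 : ℝ))) ^ 2 := by
      have hsq8 : (‖z‖ ^ (-(4 : ℝ))) ^ 2 = ‖z‖ ^ (-(8 : ℝ)) := by
        rw [← Real.rpow_natCast, ← Real.rpow_mul hz0.le]
        norm_num
      rw [mul_pow, Real.sq_sqrt (by positivity), hsq8]
      calc f (e.dataChartExt z) ^ 2 ≤ 3 * D.metric.normSq _ (D.metric.ricci _) := hsq _
        _ ≤ 3 * (K * ‖z‖ ^ (-(8 : ℝ))) := by linarith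
        _ = 3 * K * ‖z‖ ^ (-(8 : ℝ)) := by ring
    have hnn : 0 ≤ Real.sqrt (3 * K) * ‖z‖ ^ (-(4 : ℝ)) :=
      mul_nonneg (Real.sqrt_nonneg _) (Real.rpow_nonneg hz0.le _)
    exact abs_le_of_sq_le_sq' h2 hnn |>.elim (fun h1 h2 ↦ abs_le.2 ⟨h1, h2⟩)
  -- hence `|f(Φ z)|^p ≤ (√(3K))^p ‖z‖^{-4p}`
  have hptw' : ∀ z : E3, R₁ ≤ ‖z‖ →
      |f (e.dataChartExt z)| ^ p ≤ Real.sqrt (3 * K) ^ p * ‖z‖ ^ (-(4 * p)) := by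
    intro z hz
    have hz0 : 0 < ‖z‖ := lt_of_lt_of_le (lt_of_lt_of_le one_pos h1R₁) hz
    calc |f (e.dataChartExt z)| ^ p ≤ (Real.sqrt (3 * K) * ‖z‖ ^ (-(4 : ℝ))) ^ p :=
          Real.rpow_le_rpow (abs_nonneg _) (hptw z hz) hp0.le
      _ = Real.sqrt (3 * K) ^ p * ‖z‖ ^ (-(4 * p)) := by
          rw [Real.mul_rpow (Real.sqrt_nonneg _) (Real.rpow_nonneg hz0.le _),
            ← Real.rpow_mul hz0.le]
          congr 2
          ring
  -- the compact piece
  obtain ⟨Kc, hKc_cpt, hcover⟩ := hsole.exists_isCompact_cover R₂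
  have hint_K : IntegrableOn (fun x ↦ |f x| ^ p) Kc μ := hFc.continuousOn.integrableOn_compact hKc_cpt
  -- the far region
  have hint_far : IntegrableOn (fun x ↦ |f x| ^ p) (e.far R₂) μ := by
    refine ⟨hFc.aestronglyMeasurable.restrict, ?_⟩
    rw [hasFiniteIntegral_iff_enorm]
    have hen : ∀ q, ‖|f q| ^ p‖ₑ = ENNReal.ofReal (|f q| ^ p) := fun q ↦
      Real.enorm_eq_ofReal (Real.rpow_nonneg (abs_nonneg _) _)
    simp only [hen]
    rw [e.setLIntegral_far D (fun q ↦ ENNReal.ofReal (|f q| ^ p)) hRR₂]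
    have h4p : (3 : ℝ) < 4 * p := by linarith
    have hg : IntegrableOn (fun z : E3 ↦ 7 * Real.sqrt (3 * K) ^ p * ‖z‖ ^ (-(4 * p)))
        {z | R₂ < ‖z‖} volume :=
      (AFEnd.integrableOn_rpow_neg_exterior h4p (h1R₁.trans hR₁R₂)).const_mul (7 * Real.sqrt (3 * K) ^ p)
    refine lt_of_le_of_lt (setLIntegral_mono'
      (isOpen_lt continuous_const continuous_norm).measurableSet (fun z hz ↦ ?_))
      (hasFiniteIntegral_iff_enorm.1 hg.2)
    have hzR₁ : R₁ ≤ ‖z‖ := hR₁R₂.trans (le_of_lt hz)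
    have hzR₃ : R₃ ≤ ‖z‖ := hR₃R₂.trans (le_of_lt hz)
    have hz0 : 0 < ‖z‖ := lt_of_lt_of_le (lt_of_lt_of_le one_pos h1R₁) hzR₁
    have hb := hptw' z hzR₁
    have hd := hdens z hzR₃
    have hnn : 0 ≤ Real.sqrt (3 * K) ^ p * ‖z‖ ^ (-(4 * p)) :=
      mul_nonneg (Real.rpow_nonneg (Real.sqrt_nonneg _) _) (Real.rpow_nonneg hz0.le _)
    have h7 : 0 ≤ 7 * Real.sqrt (3 * K) ^ p * ‖z‖ ^ (-(4 * p)) := by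
      rw [mul_assoc]
      exact mul_nonneg (by norm_num) hnn
    calc ENNReal.ofReal (|f (e.dataChartExt z)| ^ p) * ENNReal.ofReal (Real.sqrt (Matrix.of fun i j ↦
          AFEnd.hCoeff e D z (EuclideanSpace.single i 1) (EuclideanSpace.single j 1)).det)
        ≤ ENNReal.ofReal (Real.sqrt (3 * K) ^ p * ‖z‖ ^ (-(4 * p))) * ENNReal.ofReal 7 :=
          mul_le_mul' (ENNReal.ofReal_le_ofReal hb) (ENNReal.ofReal_le_ofReal hd)
      _ = ‖7 * Real.sqrt (3 * K) ^ p * ‖z‖ ^ (-(4 * p))‖ₑ := by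
          rw [← ENNReal.ofReal_mul hnn, Real.enorm_eq_ofReal h7]
          congr 1
          ring
  -- conclusion
  exact integrableOn_univ.1 ((hint_K.union hint_far).mono_set fun q _ ↦ hcover q)

/-! ### Cor. 3.1 from elliptic regularity and the asymptotic expansion -/

/-- **Cor. 3.1 of Schoen–Yau 1979 from Folland's Cor. (6.34) and the asymptotic expansion of
Lemma 3.2.** The named fact `exists_conformal_negativeMass_of_massZero` (Comm. Math. Phys. 65
(1979), Cor. 3.1, p. 72) follows from

* `hF` — elliptic regularity, Folland 1995, Cor. (6.34) (the named fact
  `Literature.Analysis.Distribution.Folland1995_cor634`), and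
* `hasym` — the asymptotic half of Lemma 3.2 ((3.6)–(3.20), pp. 66–70): on admissible data
  (`X` oriented, one asymptotically flat end with `h − δ = o₅(r⁻²)`, `R ≥ 0`), every smooth
  solution `v ∈ L⁶(dV)` of `Δ_h v − (R/8) v = R/8` has an expansion `v = A/r + O₂(r⁻²)` in the
  chart of the end.

Everything else is proved in the tree and assembled here: the Sobolev inequality of Lemma 3.1
(`AFEnd.sobolev_inequality`), the integrability of `|R|^{3/2}` and `|R|^{6/5}`
(`integrable_abs_scalarCurvature_rpow`), the smooth energy-space solution `v` of
`Δ_h v − (R/8) v = R/8` with the bound (3.5) (`exists_smooth_solution_of_sobolev`: Lax–Milgram on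
the Dirichlet completion, `AFLinearWeakExistence.lean`, and interior regularity,
`WeakSolutionRegularity.lean`; here `θ = 0` as `R ≥ 0`), the conformal factor `φ = 1 + v` with
`Δ_h φ = Rφ/8` ((3.22)–(3.23)), and the rest of the elliptic core — positivity, the flux formula
(3.16) for `A`, the sign `A < 0`, the conformal transformation law and the mass of `φ⁴h` —
in `exists_conformal_negativeMass_of_massZero_of_solution` (`ConformalScalarFlatCore.lean`).
[cite: SchoenYauPMT1979, Cor. 3.1 (p. 72) with Lemmas 3.2–3.3 (pp. 64–72)] -/
theorem exists_conformal_negativeMass_of_massZero_of_regularity_and_asymptotics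
    (hF : Literature.Analysis.Distribution.Folland1995_cor634)
    (hasym : ∀ (X : Type) [TopologicalSpace X] [ChartedSpace E3 X] [IsManifold (𝓡 3) ∞ X]
      [T2Space X] [SecondCountableTopology X] [LocallyCompactSpace X] [ConnectedSpace X]
      [MeasurableSpace X] [BorelSpace X]
      (D : InitialDataSet (𝓡 3) X) [D.metric.HasLeviCivita] (e : AFEnd X),
      Literature.Topology.FourManifolds.IsOrientable (𝓡 3) X →
      e.IsStronglyAsymptoticallyFlatWith D 0 2 0 5 0 → e.IsSoleEnd →
      (∀ x : X, 0 ≤ D.metric.scalarCurvature x) →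
      ∀ v : X → ℝ, ContMDiff (𝓡 3) 𝓘(ℝ) ∞ v → MemLp v 6 (riemannianMeasure D.h) →
        (∀ x, D.metric.dalembertian v x - D.metric.scalarCurvature x / 8 * v x =
          D.metric.scalarCurvature x / 8) →
        ∃ A : ℝ, ∀ m : ℕ, m ≤ 2 →
          (fun x ↦ ‖iteratedFDeriv ℝ m (fun y ↦ endValue e v y - A / ‖y‖) x‖)
            =O[cobounded E3] fun x ↦ ‖x‖ ^ (-2 - m : ℝ)) :
    exists_conformal_negativeMass_of_massZero := by
  refine exists_conformal_negativeMass_of_massZero_of_solution ?_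
  intro X _ _ _ _ _ _ _ _ _ D _ e hor haf hsole hR0
  classical
  haveI : (PseudoRiemannianMetric.ofRiemannian D.h).HasLeviCivita := ‹D.metric.HasLeviCivita›
  haveI : SigmaCompactSpace X := inferInstance
  set μ : Measure X := riemannianMeasure D.h with hμ
  set Rs : X → ℝ := D.metric.scalarCurvature with hRs
  have hRsm : ContMDiff (𝓡 3) 𝓘(ℝ, ℝ) ∞ Rs := D.metric.contMDiff_scalarCurvature
  -- `f = R/8` is smooth and `|f|^{3/2}`, `|f|^{6/5}` are integrable
  obtain ⟨f, hfdef⟩ : ∃ f : X → ℝ, f = fun x ↦ Rs x / 8 := ⟨_, rfl⟩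
  have hfs : ContMDiff (𝓡 3) 𝓘(ℝ, ℝ) ∞ f := by
    rw [hfdef]
    simp_rw [div_eq_mul_inv]
    exact hRsm.mul contMDiff_const
  have hfp : ∀ {p : ℝ}, 3 / 4 < p → Integrable (fun x ↦ |f x| ^ p) μ := by
    intro p hp
    have hp0 : 0 ≤ p := (lt_trans (by norm_num) hp).le
    have h := (integrable_abs_scalarCurvature_rpow D e haf hsole hp).const_mul ((1 / 8 : ℝ) ^ p)
    refine h.congr (Eventually.of_forall fun x ↦ ?_)
    simp only [hfdef]
    rw [abs_div, abs_of_pos (by norm_num : (0 : ℝ) < 8), Real.div_rpow (abs_nonneg _) (by norm_num),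
      Real.div_rpow zero_le_one (by norm_num), Real.one_rpow]
    ring
  have hfi : Integrable (fun x ↦ |f x| ^ (3 / 2 : ℝ)) μ := hfp (by norm_num)
  have hgi : Integrable (fun x ↦ |f x| ^ (6 / 5 : ℝ)) μ := hfp (by norm_num)
  -- `f ≥ 0`, so `θ = 0`
  have hf0 : ∀ x, 0 ≤ f x := fun x ↦ by rw [hfdef]; exact div_nonneg (hR0 x) (by norm_num)
  have hneg : (fun x ↦ max (-f x) 0 ^ (3 / 2 : ℝ)) = fun _ ↦ (0 : ℝ) := by
    funext x
    rw [max_eq_right (neg_nonpos.2 (hf0 x)), Real.zero_rpow (by norm_num)]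
  -- the Sobolev inequality (Lemma 3.1)
  have hAF : e.IsMetricAsymptoticallyFlat D 2 :=
    AFEnd.IsStronglyAsymptoticallyFlatWith.isMetricAsymptoticallyFlat_of_massZero e D haf
      (by norm_num)
  obtain ⟨c₁, hc₁, hS⟩ := e.sobolev_inequality D two_pos hAF hsole
  have hθ : c₁ * (∫ x, max (-f x) 0 ^ (3 / 2 : ℝ) ∂μ) ^ (2 / 3 : ℝ) < 1 := by
    rw [hneg, integral_zero, Real.zero_rpow (by norm_num), mul_zero]
    exact one_pos
  -- the smooth solution of `Δ v − f v = f`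
  obtain ⟨v, hvs, hv6, -, hvpde⟩ := exists_smooth_solution_of_sobolev D hF hc₁ hS hfs hfs hfi hθ hgi
  -- the PDE for `v` in the form of `hasym`
  have hvpde' : ∀ x, D.metric.dalembertian v x - Rs x / 8 * v x = Rs x / 8 := fun x ↦ by
    have h := hvpde x
    rw [hfdef] at h
    exact h
  obtain ⟨A, hA⟩ := hasym X D e hor haf hsole hR0 v hvs hv6 hvpde'
  -- `Δ(v + 1) = Δ v`
  have hv2 : ContMDiff (𝓡 3) 𝓘(ℝ, ℝ) 2 v := by exact_mod_cast contMDiff_infty.1 hvs 2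
  have hΔ1 : ∀ x, D.metric.dalembertian (fun q ↦ v q + 1) x = D.metric.dalembertian v x := by
    intro x
    have hcomp : (fun q ↦ v q + 1) = (fun t : ℝ ↦ t + 1) ∘ v := rfl
    have hζ : ContDiffAt ℝ 2 (fun t : ℝ ↦ t + 1) (v x) := (contDiff_id.add contDiff_const).contDiffAt
    have hΔ := D.metric.dalembertian_real_comp (hv2 x) hζ
    have hd1 : deriv (fun t : ℝ ↦ t + 1) = fun _ ↦ 1 := by
      funext t
      rw [deriv_add_const, deriv_id'']
    have hd2 : deriv (deriv (fun t : ℝ ↦ t + 1)) (v x) = 0 := by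
      rw [hd1, deriv_const]
    rw [hcomp, hΔ, hd2, hd1, zero_mul, zero_add, one_mul]
  -- the conformal factor `φ = v + 1`
  refine ⟨fun x ↦ v x + 1, A, hvs.add contMDiff_const, fun x ↦ ?_, fun m hm ↦ ?_⟩
  · rw [hΔ1 x]
    have h := hvpde' x
    have : D.metric.dalembertian v x = Rs x / 8 * v x + Rs x / 8 := by linarith
    rw [this, hRs]
    ring
  · -- the expansion, transferred from `v` to `φ = v + 1`
    refine (hA m hm).congr' ?_ EventuallyEq.rfl
    have hfar : ∀ᶠ x in cobounded E3, e.R < ‖x‖ :=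
      tendsto_norm_cobounded_atTop.eventually (eventually_gt_atTop e.R)
    filter_upwards [hfar] with x hx
    have hloc : (fun y ↦ endValue e v y - A / ‖y‖) =ᶠ[𝓝 x]
        fun y ↦ endValue e (fun q ↦ v q + 1) y - (1 + A / ‖y‖) := by
      filter_upwards [(isOpen_lt continuous_const continuous_norm).mem_nhds hx] with y hy
      rw [endValue_of_lt e _ hy, endValue_of_lt e _ hy]
      ring
    rw [(hloc.iteratedFDeriv ℝ m).eq_of_nhds]

end Literature.Geometry.Lorentzian
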